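import Summits.BirchSwinnertonDyer.Rank1Residual.Additive.X3LineDatumOfShiftedKernelPolyCert
import HarnessLib

/-!
# `p = 13`: the kernel-polynomial certificate with (c1) checked MODULO `h` — `h ∣ preΨ'₁₃` through
# Mathlib's recursion reduced mod `h` (six identities of degree `≤ 26` instead of one of degree `84`)
# (cell `bsd-addord`, seat `bsd-addord-twist`; the Φ₀ kernel-records programme, `p = 13` rows)

HONEST FRAMING (cell `bsd-addord`, `run/shared/lean/pub/bsd-addord/README.md` §4): the programme's
target of record is the full Birch–Swinnerton-Dyer formula for every `E/ℚ` of analytic rank `≤ 1`;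
this is a TOOL file (theorems only, no definition, no named fact, no `sorry`). It books nothing.

## What

At `p = 13` the identity (c1) `preΨ'₁₃ = h · q` of the wrappers in
`X3LineDatumOf[Shifted]KernelPolyCert.lean` has degree `84` in `x` with ~200-digit coefficients — out
of reach of `ring` at default heartbeats. Only `h ∣ preΨ'₁₃` is needed (any cofactor feeds the
keystone), and divisibility can be certified in the quotient ring `ℚ[X]/(h)` (`AdjoinRoot h`,
`AdjoinRoot.mk_eq_zero`): Mathlib's recursion gives
`preΨ'₁₃ = preΨ'₈ · preΨ'₆³ · Ψ₂Sq² − preΨ'₅ · preΨ'₇³` (`preΨ'_thirteen_eq`) with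
`preΨ'₅ = preΨ₄Ψ₂Sq² − Ψ₃³`, `preΨ'₆ = Ψ₃·preΨ'₅ − Ψ₃·preΨ₄²`, `preΨ'₇ = preΨ'₅Ψ₃³ − preΨ₄³Ψ₂Sq²`,
`preΨ'₈ = Ψ₃²·preΨ₄·preΨ'₆ − preΨ₄·preΨ'₅²` (`preΨ'_six_eq`, `preΨ'_eight_eq`), and
**`dvd_preΨ'_thirteen_of_modCert`** reduces each step modulo `h`: given remainders `R₄, R₅, R₆, R₇, R₈`
(degree `< 6`) and quotients with `preΨ₄ = hQ₄ + R₄`, `R₄Ψ₂Sq² − Ψ₃³ = hQ₅ + R₅`,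
`Ψ₃R₅ − Ψ₃R₄² = hQ₆ + R₆`, `R₅Ψ₃³ − R₄³Ψ₂Sq² = hQ₇ + R₇`, `Ψ₃²R₄R₆ − R₄R₅² = hQ₈ + R₈`,
`R₈R₆³Ψ₂Sq² − R₅R₇³ = hQ₁₃`, then `h ∣ preΨ'₁₃`. **`caseOneDatum_thirteen_of_shiftedDvdCert`**: the
`p = 13` wrapper (`h = X⁶ + c₅X⁵ + ⋯ + c₀` by its integer coefficients, `h ∣ preΨ'₁₃`, the doubling
closure, the trace inequality, the shifted valuation certificate on `h(X + s)`).

References: J. H. Silverman, *AEC* 2nd ed., Exercise 3.7 [SilvermanAEC2009]; Mathlib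
`WeierstrassCurve.preΨ'_odd` / `preΨ'_even`; HOME/proof/phi0-p5/MANIFEST.tsv (the 5 rows at `p = 13`).
-/

set_option autoImplicit false

noncomputable section

open scoped Classical NumberField

open WeierstrassCurve Polynomial Literature.NumberTheory.EllipticCurves
  Literature.NumberTheory.EllipticCurves.Rank1Residual Literature.NumberTheory.GaloisRepresentations
  Field IsDedekindDomain NumberField

namespace Summit.BirchSwinnertonDyer.Rank1Residual.Additive.KernelPolyLine

/-! ## Closed forms of `preΨ'₆`, `preΨ'₈`, `preΨ'₁₃` (any curve) -/

/-- `preΨ'₆ = Ψ₃ · preΨ'₅ − Ψ₃ · preΨ₄²` (Mathlib's `preΨ'_even` at `m = 0`). [folklore] -/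
theorem preΨ'_six_eq {R : Type*} [CommRing R] (V : WeierstrassCurve R) :
    V.preΨ' 6 = V.Ψ₃ * V.preΨ' 5 - V.Ψ₃ * V.preΨ₄ ^ 2 := by
  rw [show (6 : ℕ) = 2 * (0 + 3) from rfl, preΨ'_even]
  simp only [zero_add, preΨ'_four, preΨ'_two, preΨ'_one, preΨ'_three, one_pow, one_mul]

/-- `preΨ'₈ = Ψ₃² · preΨ₄ · preΨ'₆ − preΨ₄ · preΨ'₅²` (Mathlib's `preΨ'_even` at `m = 1`). [folklore] -/
theorem preΨ'_eight_eq {R : Type*} [CommRing R] (V : WeierstrassCurve R) :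
    V.preΨ' 8 = V.Ψ₃ ^ 2 * V.preΨ₄ * V.preΨ' 6 - V.preΨ₄ * V.preΨ' 5 ^ 2 := by
  rw [show (8 : ℕ) = 2 * (1 + 3) from rfl, preΨ'_even]
  simp only [show 1 + 2 = 3 from rfl, show 1 + 3 = 4 from rfl, show 1 + 5 = 6 from rfl,
    show 1 + 1 = 2 from rfl, show 1 + 4 = 5 from rfl, preΨ'_four, preΨ'_two, preΨ'_three, one_mul]

/-- `preΨ'₁₃ = preΨ'₈ · preΨ'₆³ · Ψ₂Sq² − preΨ'₅ · preΨ'₇³` (Mathlib's `preΨ'_odd` at `m = 4`).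
[folklore] -/
theorem preΨ'_thirteen_eq {R : Type*} [CommRing R] (V : WeierstrassCurve R) :
    V.preΨ' 13 = V.preΨ' 8 * V.preΨ' 6 ^ 3 * V.Ψ₂Sq ^ 2 - V.preΨ' 5 * V.preΨ' 7 ^ 3 := by
  rw [show (13 : ℕ) = 2 * (4 + 2) + 1 from rfl, preΨ'_odd]
  rw [if_pos (by decide : Even (4 : ℕ)), if_pos (by decide : Even (4 : ℕ))]
  simp only [show 4 + 4 = 8 from rfl, show 4 + 2 = 6 from rfl, show 4 + 1 = 5 from rfl,
    show 4 + 3 = 7 from rfl, mul_one]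

/-! ## `h ∣ preΨ'₁₃` from the recursion reduced modulo `h` -/

/-- **Modular certificate for `h ∣ preΨ'₁₃`.** With remainders `R₄, …, R₈` and quotients
`Q₄, …, Q₈, Q₁₃` satisfying the six displayed identities (each of degree `≤ 26` in `X` when
`deg h = 6`, `deg Rᵢ < 6`), `h` divides `preΨ'₁₃` — computed in `ℚ[X]/(h)` along Mathlib's recursion.
[cite: SilvermanAEC2009, Exercise 3.7] -/
theorem dvd_preΨ'_thirteen_of_modCert (W : WeierstrassCurve ℚ)
    (h R₄ R₅ R₆ R₇ R₈ Q₄ Q₅ Q₆ Q₇ Q₈ Q₁₃ : ℚ[X])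
    (h4 : W.preΨ₄ = h * Q₄ + R₄)
    (h5 : R₄ * W.Ψ₂Sq ^ 2 - W.Ψ₃ ^ 3 = h * Q₅ + R₅)
    (h6 : W.Ψ₃ * R₅ - W.Ψ₃ * R₄ ^ 2 = h * Q₆ + R₆)
    (h7 : R₅ * W.Ψ₃ ^ 3 - R₄ ^ 3 * W.Ψ₂Sq ^ 2 = h * Q₇ + R₇)
    (h8 : W.Ψ₃ ^ 2 * R₄ * R₆ - R₄ * R₅ ^ 2 = h * Q₈ + R₈)
    (h13 : R₈ * R₆ ^ 3 * W.Ψ₂Sq ^ 2 - R₅ * R₇ ^ 3 = h * Q₁₃) : h ∣ W.preΨ' 13 := by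
  rw [← AdjoinRoot.mk_eq_zero]
  have hmk : AdjoinRoot.mk h h = 0 := AdjoinRoot.mk_self
  have e4 : AdjoinRoot.mk h W.preΨ₄ = AdjoinRoot.mk h R₄ := by
    rw [h4, map_add, map_mul, hmk, zero_mul, zero_add]
  have e5 : AdjoinRoot.mk h (W.preΨ' 5) = AdjoinRoot.mk h R₅ := by
    rw [preΨ'_five_eq, map_sub, map_mul, map_pow, map_pow, e4, ← map_pow, ← map_pow, ← map_mul, ← map_sub,
      h5, map_add, map_mul, hmk, zero_mul, zero_add]
  have e6 : AdjoinRoot.mk h (W.preΨ' 6) = AdjoinRoot.mk h R₆ := by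
    rw [preΨ'_six_eq, map_sub, map_mul, map_mul, map_pow, e5, e4, ← map_pow, ← map_mul, ← map_mul,
      ← map_sub, h6, map_add, map_mul, hmk, zero_mul, zero_add]
  have e7 : AdjoinRoot.mk h (W.preΨ' 7) = AdjoinRoot.mk h R₇ := by
    rw [preΨ'_seven_eq, ← preΨ'_five_eq, map_sub, map_mul, map_mul, map_pow, map_pow, map_pow, e5, e4,
      ← map_pow, ← map_pow, ← map_pow, ← map_mul, ← map_mul, ← map_sub, h7, map_add, map_mul, hmk,
      zero_mul, zero_add]
  have e8 : AdjoinRoot.mk h (W.preΨ' 8) = AdjoinRoot.mk h R₈ := by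
    rw [preΨ'_eight_eq, map_sub, map_mul, map_mul, map_mul, map_pow, map_pow, e6, e5, e4, ← map_pow,
      ← map_pow, ← map_mul, ← map_mul, ← map_mul, ← map_sub, h8, map_add, map_mul, hmk, zero_mul, zero_add]
  rw [preΨ'_thirteen_eq, map_sub, map_mul, map_mul, map_mul, map_pow, map_pow, map_pow, e8, e6, e5, e7,
    ← map_pow, ← map_pow, ← map_pow, ← map_mul, ← map_mul, ← map_mul, ← map_sub, h13, map_mul, hmk,
    zero_mul]

/-! ## The `p = 13` wrapper -/

variable {W : WeierstrassCurve ℚ} [W.IsElliptic] [W.IsGloballyMinimal]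

/-- **`p = 13` with shift and modular (c1)** (`h = X⁶ + c₅X⁵ + ⋯ + c₀`, `g = h(X + s)`):
`CaseOneDatum W 13` from `h ∣ preΨ'₁₃` (e.g. `dvd_preΨ'_thirteen_of_modCert`), the doubling closure,
`±2` generates `𝔽₁₃ˣ`, the trace inequality (`E₁ = −c₅`, `E₂ = c₄`, `E₃ = −c₃`), and the valuation
certificate `13^{6−k} ∣ g_k` (`0 < k < 6`), `g₀ = 13⁵a`, `13 ∤ a` on the translate.
[cite: GreenbergVatsal2000, §2 p. 28] -/
theorem caseOneDatum_thirteen_of_shiftedDvdCert [Fact (Nat.Prime 13)] (hX : ClassX3Gord W 13)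
    (he : semistabilityIndex W 13 = 2) (c₅ c₄ c₃ c₂ c₁ c₀ s a : ℤ) (q₂ : ℚ[X])
    (hdvd : (X ^ 6 + C (c₅ : ℚ) * X ^ 5 + C (c₄ : ℚ) * X ^ 4 + C (c₃ : ℚ) * X ^ 3 +
      C (c₂ : ℚ) * X ^ 2 + C (c₁ : ℚ) * X + C (c₀ : ℚ)) ∣ W.preΨ' 13)
    (hdbl : C (c₀ : ℚ) * W.Ψ₂Sq ^ 6 + C (c₁ : ℚ) * W.Φ 2 * W.Ψ₂Sq ^ 5 + C (c₂ : ℚ) * W.Φ 2 ^ 2 * W.Ψ₂Sq ^ 4 +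
      C (c₃ : ℚ) * W.Φ 2 ^ 3 * W.Ψ₂Sq ^ 3 + C (c₄ : ℚ) * W.Φ 2 ^ 4 * W.Ψ₂Sq ^ 2 +
      C (c₅ : ℚ) * W.Φ 2 ^ 5 * W.Ψ₂Sq + W.Φ 2 ^ 6 =
      (X ^ 6 + C (c₅ : ℚ) * X ^ 5 + C (c₄ : ℚ) * X ^ 4 + C (c₃ : ℚ) * X ^ 3 + C (c₂ : ℚ) * X ^ 2 +
        C (c₁ : ℚ) * X + C (c₀ : ℚ)) * q₂)
    (hT : 0 < 4 * ((-(c₅ : ℚ)) ^ 3 - 3 * (-(c₅ : ℚ)) * c₄ + 3 * (-(c₃ : ℚ))) +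
      W.b₂ * ((-(c₅ : ℚ)) ^ 2 - 2 * c₄) + 2 * W.b₄ * (-(c₅ : ℚ)) + (6 : ℕ) * W.b₆)
    (hg₅ : (13 : ℤ) ∣ c₅ + 6 * s) (hg₄ : (13 : ℤ) ^ 2 ∣ c₄ + 5 * c₅ * s + 15 * s ^ 2)
    (hg₃ : (13 : ℤ) ^ 3 ∣ c₃ + 4 * c₄ * s + 10 * c₅ * s ^ 2 + 20 * s ^ 3)
    (hg₂ : (13 : ℤ) ^ 4 ∣ c₂ + 3 * c₃ * s + 6 * c₄ * s ^ 2 + 10 * c₅ * s ^ 3 + 15 * s ^ 4)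
    (hg₁ : (13 : ℤ) ^ 5 ∣ c₁ + 2 * c₂ * s + 3 * c₃ * s ^ 2 + 4 * c₄ * s ^ 3 + 5 * c₅ * s ^ 4 + 6 * s ^ 5)
    (hg₀ : c₀ + c₁ * s + c₂ * s ^ 2 + c₃ * s ^ 3 + c₄ * s ^ 4 + c₅ * s ^ 5 + s ^ 6 = 13 ^ 5 * a)
    (ha : ¬ (13 : ℤ) ∣ a) : CaseOneDatum W 13 := by
  set h : ℚ[X] := X ^ 6 + C (c₅ : ℚ) * X ^ 5 + C (c₄ : ℚ) * X ^ 4 + C (c₃ : ℚ) * X ^ 3 +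
      C (c₂ : ℚ) * X ^ 2 + C (c₁ : ℚ) * X + C (c₀ : ℚ) with hh
  obtain ⟨q, hq⟩ := hdvd
  have hmon : h.Monic := by rw [hh]; monicity!
  have hdegm : h.natDegree = 6 := by rw [hh]; compute_degree!
  have hc0 : h.coeff 0 = c₀ := by
    rw [hh]; simp only [coeff_add, coeff_C_mul, coeff_X_pow, coeff_X, coeff_C]; norm_num
  have hc1 : h.coeff 1 = c₁ := by
    rw [hh]; simp only [coeff_add, coeff_C_mul, coeff_X_pow, coeff_X, coeff_C]; norm_num
  have hc2 : h.coeff 2 = c₂ := by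
    rw [hh]; simp only [coeff_add, coeff_C_mul, coeff_X_pow, coeff_X, coeff_C]; norm_num
  have hc3 : h.coeff 3 = c₃ := by
    rw [hh]; simp only [coeff_add, coeff_C_mul, coeff_X_pow, coeff_X, coeff_C]; norm_num
  have hc4 : h.coeff 4 = c₄ := by
    rw [hh]; simp only [coeff_add, coeff_C_mul, coeff_X_pow, coeff_X, coeff_C]; norm_num
  have hc5 : h.coeff 5 = c₅ := by
    rw [hh]; simp only [coeff_add, coeff_C_mul, coeff_X_pow, coeff_X, coeff_C]; norm_num
  have hc6 : h.coeff 6 = 1 := by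
    rw [hh]; simp only [coeff_add, coeff_C_mul, coeff_X_pow, coeff_X, coeff_C]; norm_num
  have hg : h.comp (X + C (s : ℚ)) =
      X ^ 6 + C ((c₅ + 6 * s : ℤ) : ℚ) * X ^ 5 + C ((c₄ + 5 * c₅ * s + 15 * s ^ 2 : ℤ) : ℚ) * X ^ 4 +
        C ((c₃ + 4 * c₄ * s + 10 * c₅ * s ^ 2 + 20 * s ^ 3 : ℤ) : ℚ) * X ^ 3 +
        C ((c₂ + 3 * c₃ * s + 6 * c₄ * s ^ 2 + 10 * c₅ * s ^ 3 + 15 * s ^ 4 : ℤ) : ℚ) * X ^ 2 +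
        C ((c₁ + 2 * c₂ * s + 3 * c₃ * s ^ 2 + 4 * c₄ * s ^ 3 + 5 * c₅ * s ^ 4 + 6 * s ^ 5 : ℤ) : ℚ) * X +
        C ((c₀ + c₁ * s + c₂ * s ^ 2 + c₃ * s ^ 3 + c₄ * s ^ 4 + c₅ * s ^ 5 + s ^ 6 : ℤ) : ℚ) := by
    rw [hh]
    simp only [add_comp, mul_comp, X_pow_comp, X_comp, C_comp]
    push_cast
    simp only [map_add, map_mul, map_pow, map_intCast, map_ofNat]
    ring
  have hg0 : (h.comp (X + C (s : ℚ))).coeff 0 =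
      ((c₀ + c₁ * s + c₂ * s ^ 2 + c₃ * s ^ 3 + c₄ * s ^ 4 + c₅ * s ^ 5 + s ^ 6 : ℤ) : ℚ) := by
    rw [hg]; simp only [coeff_add, coeff_C_mul, coeff_X_pow, coeff_X, coeff_C]; norm_num
  have hg1 : (h.comp (X + C (s : ℚ))).coeff 1 =
      ((c₁ + 2 * c₂ * s + 3 * c₃ * s ^ 2 + 4 * c₄ * s ^ 3 + 5 * c₅ * s ^ 4 + 6 * s ^ 5 : ℤ) : ℚ) := by
    rw [hg]; simp only [coeff_add, coeff_C_mul, coeff_X_pow, coeff_X, coeff_C]; norm_num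
  have hg2 : (h.comp (X + C (s : ℚ))).coeff 2 =
      ((c₂ + 3 * c₃ * s + 6 * c₄ * s ^ 2 + 10 * c₅ * s ^ 3 + 15 * s ^ 4 : ℤ) : ℚ) := by
    rw [hg]; simp only [coeff_add, coeff_C_mul, coeff_X_pow, coeff_X, coeff_C]; norm_num
  have hg3 : (h.comp (X + C (s : ℚ))).coeff 3 =
      ((c₃ + 4 * c₄ * s + 10 * c₅ * s ^ 2 + 20 * s ^ 3 : ℤ) : ℚ) := by
    rw [hg]; simp only [coeff_add, coeff_C_mul, coeff_X_pow, coeff_X, coeff_C]; norm_num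
  have hg4 : (h.comp (X + C (s : ℚ))).coeff 4 = ((c₄ + 5 * c₅ * s + 15 * s ^ 2 : ℤ) : ℚ) := by
    rw [hg]; simp only [coeff_add, coeff_C_mul, coeff_X_pow, coeff_X, coeff_C]; norm_num
  have hg5 : (h.comp (X + C (s : ℚ))).coeff 5 = ((c₅ + 6 * s : ℤ) : ℚ) := by
    rw [hg]; simp only [coeff_add, coeff_C_mul, coeff_X_pow, coeff_X, coeff_C]; norm_num
  refine ClassX3Gord.caseOneDatum_of_shiftedKernelPolyCert hX (by norm_num) he (m := 6) rfl hmon hdegm hq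
    (q₂ := q₂) ?_ gen_thirteen (E₁ := -(c₅ : ℚ)) (E₂ := (c₄ : ℚ)) (E₃ := -(c₃ : ℚ)) (by rw [hc5, neg_neg])
    (by rw [hc4]) (Or.inl ⟨by norm_num, by rw [hc3, neg_neg]⟩) hT s ?_ ?_
  · simp only [Finset.sum_range_succ, Finset.sum_range_zero, zero_add, hc0, hc1, hc2, hc3, hc4, hc5,
      hc6, pow_zero, pow_one, Nat.sub_zero, Nat.sub_self, show 6 - 1 = 5 from rfl,
      show 6 - 2 = 4 from rfl, show 6 - 3 = 3 from rfl, show 6 - 4 = 2 from rfl, show 6 - 5 = 1 from rfl,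
      mul_one, one_mul, map_one]
    rw [← hdbl]
  · intro k hk0 hk6
    interval_cases k
    · exact ⟨_, hg1, hg₁⟩
    · exact ⟨_, hg2, hg₂⟩
    · exact ⟨_, hg3, hg₃⟩
    · exact ⟨_, hg4, hg₄⟩
    · exact ⟨_, hg5, by rw [pow_one]; exact hg₅⟩
  · exact ⟨a, by rw [hg0, hg₀]; push_cast; ring, ha⟩

end Summit.BirchSwinnertonDyer.Rank1Residual.Additive.KernelPolyLine

end
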